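import Mathlib.GroupTheory.Index
import HarnessLib

/-!
# Route `ByReductionTypeAtTwo`, crux `MultUpperHalfAtTwo` (item stmt-BirchSwinnertonDyer-19922), TOWER road, the
# «ONE BIT AT A NON-SPLIT 2» rows: KERNEL BRICK 7 — the index count that replaces reciprocity in the tower non-norm
# induction: a norm map to an index-`2` image, with norm subgroups of indices `M` and `2M`, detects membership

HONEST FRAMING (cell `bsd-2adic`, run/shared/lean/pub/bsd-2adic/, seat `bsd-2adic-tower-1` GEN 8, HUMAN RULINGS
D-0036 / D-0054 / D-0074): TOOL theorems only (no definition, no named fact, no `sorry`); closes nothing by itself;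
nothing booked; BSD is not proved by any of this. Abstract group theory for step S5 (levels `r ≥ 2`) of the KERNELISATION
of the displayed MEMO binder `MultTowerNS2.localTowerKerTwoTorsion_le_two_nonsplitTwo_of_tateUnit` (scope
HOME/tower/SCOPE-hNS2one-kernel-GEN8.md): in the cyclotomic `ℤ₂`-tower `F_n ⊂ F_{n+1} ⊂ F_{n+r+1}` of local fields the
CLASS FIELD AXIOM alone (a tree THEOREM, `GaloisRepresentations.cyclicNormIndexEq_holds`: `(Kˣ : N Lˣ) = [L:K]` for cyclic
`L/K`) gives `[F_{n+1}ˣ : N F_{n+r+1}ˣ] = 2^r`, `[F_nˣ : N F_{n+r+1}ˣ] = 2^{r+1}`, `[F_nˣ : N F_{n+1}ˣ] = 2`, and THEN — this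
file — the norm `N_{F_{n+1}/F_n}` induces an INJECTION `F_{n+1}ˣ/N F_{n+r+1}ˣ ↪ F_nˣ/N F_{n+r+1}ˣ`: an element of
`F_{n+1}ˣ` whose norm to `F_n` is a norm from `F_{n+r+1}` is itself a norm from `F_{n+r+1}`; in particular
`ξ/γξ ∈ N(F_{n+r+1}ˣ)` (memo S5: «γ acts trivially on `F_{n+1}ˣ/N`», which local reciprocity would give from
`Gal` being abelian — here from three COUNTS, no reciprocity map, no Brauer group).

* `comap_map_eq_of_index` — for a hom `N : A' → A` of groups with `[A : N(A')] = 2` and a subgroup `B' ≤ A'` with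
  `[A' : B'] = M`, `[A : N(B')] = 2M` (`0 < M`): `N⁻¹(N(B')) = B'`;
* `mem_of_map_mem_map_of_index` — elementwise form; `div_conj_mem_of_index` — `ξ·(σ ξ)⁻¹ ∈ B'` for any
  endomorphism `σ` of `A'` with `N ∘ σ = N` (e.g. a Galois conjugation commuting with the norm).

References: cell memo PROOF-NS2ONE.md §4; scope memo SCOPE-hNS2one-kernel-GEN8.md S5 (v1 F5); J. Neukirch, *Algebraic
Number Theory*, V (1.1) (the class field axiom whose counts are consumed).
-/

set_option autoImplicit false
-- the Theorems namespace of this sub repeats the summit name by design (D-0017 nested layout: Summit.<S>.<Sub>)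
set_option linter.dupNamespace false

namespace Summit.BirchSwinnertonDyer.BirchSwinnertonDyer.Theorems.MultTowerNS2

variable {A A' : Type*} [Group A] [Group A'] (N : A' →* A) (B' : Subgroup A')

/-- **Counting lemma.** Let `N : A' → A` be a group homomorphism whose image has index `2`, and `B' ≤ A'` a subgroup
of finite index `M` whose image `N(B')` has index `2M` in `A`. Then `N⁻¹(N(B')) = B'` — the induced map
`A'/B' → A/N(B')` is injective. (Indices: `[A' : N⁻¹(N B')] = [N(A') : N(B')] = [A : N(B')]/[A : N(A')] = M = [A' : B']`
and `B' ≤ N⁻¹(N B')`.) [folklore] -/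
theorem comap_map_eq_of_index {M : ℕ} (hM : 0 < M) (hrange : N.range.index = 2) (hB' : B'.index = M)
    (hB : (B'.map N).index = 2 * M) : (B'.map N).comap N = B' := by
  have hle : B' ≤ (B'.map N).comap N := Subgroup.le_comap_map N B'
  -- `[A' : N⁻¹(N B')] = [N B' :_{rel} N A'] = M`
  have hK : ((B'.map N).comap N).index = M := by
    rw [Subgroup.index_comap]
    have h := Subgroup.relIndex_mul_index (Subgroup.map_le_range N B')
    rw [hrange, hB] at h
    omega
  -- equal indices and `B' ≤ N⁻¹(N B')` force equality
  have hrel := Subgroup.relIndex_mul_index hle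
  rw [hK, hB'] at hrel
  have h1 : B'.relIndex ((B'.map N).comap N) = 1 := by
    have : B'.relIndex ((B'.map N).comap N) * M = 1 * M := by rw [one_mul]; exact hrel
    exact Nat.eq_of_mul_eq_mul_right hM this
  exact le_antisymm (Subgroup.relIndex_eq_one.mp h1) hle

/-- **Elementwise form**: under the hypotheses of `comap_map_eq_of_index`, an element of `A'` whose image under `N`
lies in `N(B')` lies in `B'` («an element of `F_{n+1}ˣ` whose norm to `F_n` is a norm from `F_{n+r+1}` is a norm
from `F_{n+r+1}`»). [folklore] -/
theorem mem_of_map_mem_map_of_index {M : ℕ} (hM : 0 < M) (hrange : N.range.index = 2) (hB' : B'.index = M)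
    (hB : (B'.map N).index = 2 * M) {ξ : A'} (hξ : N ξ ∈ B'.map N) : ξ ∈ B' := by
  rw [← comap_map_eq_of_index N B' hM hrange hB' hB]
  exact hξ

/-- **`ξ (σξ)⁻¹ ∈ B'`** for every `ξ ∈ A'` and every endomorphism `σ` of `A'` with `N ∘ σ = N` (a Galois conjugation
of `F_{n+1}/F_n` commutes with the norm to `F_n`), under the hypotheses of `comap_map_eq_of_index`: the substitute,
from COUNTS, for «`Gal` acts trivially on `F_{n+1}ˣ/N F_{n+r+1}ˣ`» (memo PROOF-NS2ONE §4 / scope S5). [folklore] -/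
theorem div_conj_mem_of_index {M : ℕ} (hM : 0 < M) (hrange : N.range.index = 2) (hB' : B'.index = M)
    (hB : (B'.map N).index = 2 * M) (σ : A' →* A') (hσ : ∀ x, N (σ x) = N x) (ξ : A') :
    ξ * (σ ξ)⁻¹ ∈ B' := by
  refine mem_of_map_mem_map_of_index N B' hM hrange hB' hB ?_
  rw [map_mul, map_inv, hσ, mul_inv_cancel]
  exact one_mem _

end Summit.BirchSwinnertonDyer.BirchSwinnertonDyer.Theorems.MultTowerNS2
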